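import Literature.RepresentationTheory.HeisenbergGroup.WeylSystemVacuumProjection
import HarnessLib

/-!
# The vacuum subspace of a Weyl system: closedness, orthogonal projection, coefficients, totality, commutant (von Neumann 1931, §4–5; Folland 1989 Thm (1.50))

Topic `RepresentationTheory/HeisenbergGroup`; namespace `Literature.RepresentationTheory.HeisenbergGroup`.

Continuation of `WeylSystemVacuumProjection`: there, for a Weyl system `W` over a finite-dimensional real inner
product space `V` with compatible complex structure `J` on a Hilbert space `E`, von Neumann's Gaussian average
`P = vacuumVec W` was shown to satisfy `P W(w) P = e^{-(π/2)‖w‖²} P`, `P† = P = P²`, `P ≠ 0`.  Von Neumann's proof of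
uniqueness continues (Math. Ann. 104, §5; Folland, proof of Thm (1.50)): the range `M₀` of `P` — the **vacuum
subspace** — controls the whole representation:

* §1 `vacuumVec_add`, `norm_vacuumVec_le` (`‖P u‖ ≤ (∫γ)‖u‖`), the submodule **`vacuumSubspace`** `M₀ = {v | P v = v}`,
  `isClosed_vacuumSubspace`, `vacuumVec_mem_vacuumSubspace`, `sub_vacuumVec_mem_orthogonal` (`P` is the orthogonal
  projection onto `M₀`);
* §2 **coefficients on the vacuum subspace**: `inner_apply_of_mem_vacuumSubspace`
  (`⟪W(z) m, m'⟫ = γ(z) ⟪m, m'⟫`) and `inner_apply_apply_of_mem_vacuumSubspace`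
  (`⟪W(x) m, W(y) m'⟫ = 𝐞(½⟪y, J x⟫) γ(x − y) ⟪m, m'⟫`) for `m, m' ∈ M₀` — von Neumann's "the `W(x) M₀` are mutually
  positioned like the coherent states";
* §3 **totality**: `eq_zero_of_forall_vacuumVec_apply_eq_zero` (`P W(a) u = 0` for all `a` forces `u = 0`, Fourier
  inversion) and `eq_zero_of_forall_inner_apply_eq_zero` (a vector orthogonal to every `W(x) m`, `m ∈ M₀`, is zero:
  the translates of the vacuum subspace are TOTAL in `E`);
* §4 **commutant**: a bounded operator commuting with every `W(x)` commutes with `P` and preserves `M₀`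
  (`apply_vacuumVec_of_commute`, `mem_vacuumSubspace_of_commute`).

These are the inputs of the isotypic decomposition `E ≅ L² ⊗ M₀` and of the reduction of a commuting second
action to `M₀` (the gluing of places in the adelic uniqueness of `ρ_ψ`, [GelbartRogawski1991, §3.1 p. 454 L20–21]).
Everything is PROVED (Mathlib + tree); no cited statement is used as a hypothesis.

## References

* [vonNeumann1931] J. von Neumann, Die Eindeutigkeit der Schrödingerschen Operatoren, Math. Ann. 104 (1931)
  570–578, §§4–5.
* [Folland1989] G. B. Folland, *Harmonic Analysis in Phase Space*, Princeton University Press, 1989, §1.5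
  Theorem (1.50) and its proof (doi:10.1515/9781400882427).
-/

noncomputable section

open MeasureTheory Complex Filter
open scoped InnerProductSpace FourierTransform ComplexConjugate Topology

namespace Literature.RepresentationTheory.HeisenbergGroup

variable {V : Type*} [NormedAddCommGroup V] [InnerProductSpace ℝ V] [FiniteDimensional ℝ V]
  [MeasurableSpace V] [BorelSpace V]
variable {E : Type*} [NormedAddCommGroup E] [InnerProductSpace ℂ E]

namespace IsWeylSystem

variable {J : V →ₗ[ℝ] V} {W : V → E →L[ℂ] E}

/-! ## 1. The vacuum subspace -/

/-- `P` is additive. [cite: vonNeumann1931, §4] -/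
theorem vacuumVec_add (hW : IsWeylSystem J W) (u v : E) :
    vacuumVec W (u + v) = vacuumVec W u + vacuumVec W v := by
  unfold vacuumVec
  rw [← integral_add (hW.integrable_gauss_smul_apply u) (hW.integrable_gauss_smul_apply v)]
  congr 1
  funext z
  rw [map_add, smul_add]

/-- `P` is bounded: `‖P u‖ ≤ (∫ γ) ‖u‖`. [cite: vonNeumann1931, §4] -/
theorem norm_vacuumVec_le (hW : IsWeylSystem J W) (u : E) :
    ‖vacuumVec W u‖ ≤ (∫ z : V, gauss z) * ‖u‖ := by
  unfold vacuumVec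
  calc ‖∫ z : V, (gauss z : ℂ) • W z u‖ ≤ ∫ z : V, ‖(gauss z : ℂ) • W z u‖ := norm_integral_le_integral_norm _
    _ = ∫ z : V, gauss z * ‖u‖ := by
        congr 1
        funext z
        rw [norm_smul, norm_ofReal_gauss, hW.norm_map]
    _ = (∫ z : V, gauss z) * ‖u‖ := integral_mul_const _ _

/-- `P (u - v) = P u - P v`. [cite: vonNeumann1931, §4] -/
theorem vacuumVec_sub (hW : IsWeylSystem J W) (u v : E) :
    vacuumVec W (u - v) = vacuumVec W u - vacuumVec W v := by
  rw [sub_eq_add_neg, hW.vacuumVec_add, ← neg_one_smul ℂ v, vacuumVec_smul, neg_one_smul, ← sub_eq_add_neg]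

/-- **The vacuum subspace** `M₀ = {v | P v = v}` of a Weyl system (the range of von Neumann's projection `A`).
[cite: vonNeumann1931, §5; Folland1989, §1.5 proof of Theorem (1.50)] -/
def vacuumSubspace (hW : IsWeylSystem J W) : Submodule ℂ E where
  carrier := {v | vacuumVec W v = v}
  add_mem' {u v} hu hv := by
    change vacuumVec W (u + v) = u + v
    rw [hW.vacuumVec_add, hu, hv]
  zero_mem' := by
    change vacuumVec W 0 = 0
    simpa using vacuumVec_smul W (0 : ℂ) (0 : E)
  smul_mem' c {v} hv := by
    change vacuumVec W (c • v) = c • v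
    rw [vacuumVec_smul, hv]

/-- membership in `M₀`. [cite: vonNeumann1931, §5] -/
theorem mem_vacuumSubspace (hW : IsWeylSystem J W) {v : E} : v ∈ hW.vacuumSubspace ↔ vacuumVec W v = v :=
  Iff.rfl

/-- **`M₀` is closed** (`P` is bounded). [cite: vonNeumann1931, §5] -/
theorem isClosed_vacuumSubspace (hW : IsWeylSystem J W) : IsClosed (hW.vacuumSubspace : Set E) := by
  have hC : 0 ≤ ∫ z : V, gauss z := integral_nonneg fun z => (gauss_pos z).le
  have hlip : LipschitzWith (Real.toNNReal ((∫ z : V, gauss z) + 1)) (vacuumVec W : E → E) := by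
    refine LipschitzWith.of_dist_le_mul fun u v => ?_
    rw [dist_eq_norm, dist_eq_norm, ← hW.vacuumVec_sub, Real.coe_toNNReal _ (by linarith)]
    refine (hW.norm_vacuumVec_le _).trans ?_
    nlinarith [norm_nonneg (u - v)]
  exact isClosed_eq hlip.continuous continuous_id

variable [CompleteSpace E]

/-- `P u ∈ M₀` (`P² = P`). [cite: vonNeumann1931, §4] -/
theorem vacuumVec_mem_vacuumSubspace (hW : IsWeylSystem J W) (u : E) : vacuumVec W u ∈ hW.vacuumSubspace :=
  hW.vacuumVec_vacuumVec u

/-- **`P` is the orthogonal projection onto `M₀`**: `u - P u ⊥ M₀`. [cite: vonNeumann1931, §4] -/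
theorem sub_vacuumVec_mem_orthogonal (hW : IsWeylSystem J W) (u : E) :
    u - vacuumVec W u ∈ hW.vacuumSubspaceᗮ := by
  rw [Submodule.mem_orthogonal]
  intro m hm
  rw [inner_sub_right, ← hW.inner_vacuumVec_comm, (hW.mem_vacuumSubspace).mp hm, sub_self]

/-! ## 2. Coefficients on the vacuum subspace -/

/-- **`⟪W(z) m, m'⟫ = γ(z) ⟪m, m'⟫` for vacuum vectors** (polarised form of the forced diagonal coefficient).
[cite: vonNeumann1931, §5; Folland1989, §1.5 proof of Theorem (1.50)] -/
theorem inner_apply_of_mem_vacuumSubspace (hW : IsWeylSystem J W) {m m' : E} (hm : m ∈ hW.vacuumSubspace)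
    (hm' : m' ∈ hW.vacuumSubspace) (z : V) : ⟪W z m, m'⟫_ℂ = (gauss z : ℂ) * ⟪m, m'⟫_ℂ := by
  rw [hW.mem_vacuumSubspace] at hm hm'
  calc ⟪W z m, m'⟫_ℂ = ⟪W z m, vacuumVec W m'⟫_ℂ := by rw [hm']
    _ = ⟪vacuumVec W (W z m), m'⟫_ℂ := (hW.inner_vacuumVec_comm _ _).symm
    _ = ⟪vacuumVec W (W z (vacuumVec W m)), m'⟫_ℂ := by rw [hm]
    _ = ⟪(gauss z : ℂ) • vacuumVec W m, m'⟫_ℂ := by rw [hW.vacuumVec_weyl_vacuumVec]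
    _ = (gauss z : ℂ) * ⟪m, m'⟫_ℂ := by rw [hm, inner_smul_left, Complex.conj_ofReal]

/-- **`⟪W(x) m, W(y) m'⟫ = 𝐞(½⟪y, J x⟫) γ(x - y) ⟪m, m'⟫`** for vacuum vectors: the translates `W(x) M₀` of the
vacuum subspace are positioned like coherent states. [cite: vonNeumann1931, §5] -/
theorem inner_apply_apply_of_mem_vacuumSubspace (hW : IsWeylSystem J W) {m m' : E} (hm : m ∈ hW.vacuumSubspace)
    (hm' : m' ∈ hW.vacuumSubspace) (x y : V) :
    ⟪W x m, W y m'⟫_ℂ = ((𝐞 (⟪y, J x⟫_ℝ / 2) : Circle) : ℂ) * (gauss (x - y) : ℂ) * ⟪m, m'⟫_ℂ := by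
  rw [hW.inner_apply_right, hW.mul, inner_smul_left, hW.inner_apply_of_mem_vacuumSubspace hm hm',
    neg_add_eq_sub, ← mul_assoc, ← Circle.coe_inv_eq_conj, ← AddChar.map_neg_eq_inv, inner_neg_left, neg_div,
    neg_neg]

/-! ## 3. Totality of the translates of the vacuum subspace -/

/-- If `P W(a) u = 0` for every `a`, then `u = 0` (the Fourier transform of `z ↦ γ(z)⟪u, W(z)u⟫` vanishes
identically, cf. `exists_vacuumVec_ne_zero`). [cite: vonNeumann1931, §5; Folland1989, §1.5 proof of Theorem (1.50)] -/
theorem eq_zero_of_forall_vacuumVec_apply_eq_zero (hW : IsWeylSystem J W) {u : E}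
    (h : ∀ a : V, vacuumVec W (W a u) = 0) : u = 0 := by
  have hFG : 𝓕 (fun z : V => (gauss z : ℂ) * ⟪u, W z u⟫_ℂ) = 0 := by
    funext ξ
    obtain ⟨a, rfl⟩ := hW.surjective_J ξ
    rw [Pi.zero_apply, ← hW.inner_apply_vacuumVec_apply_neg, h, map_zero, inner_zero_right]
  have hinv := (hW.continuous_gauss_mul_inner u).fourierInv_fourier_eq (hW.integrable_gauss_mul_inner u)
    (by rw [hFG]; exact integrable_zero _ _ _)
  rw [hFG] at hinv
  have h0 : (fun z : V => (gauss z : ℂ) * ⟪u, W z u⟫_ℂ) 0 = 0 := by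
    rw [← hinv, Real.fourierInv_eq]
    simp
  have h1 : (fun z : V => (gauss z : ℂ) * ⟪u, W z u⟫_ℂ) 0 = (‖u‖ : ℂ) ^ 2 := by
    simp only [gauss_zero, Complex.ofReal_one, one_mul, hW.apply_zero, inner_self_eq_norm_sq_to_K]
    norm_cast
  rw [h1] at h0
  simpa using h0

/-- **Totality**: a vector orthogonal to every translate `W(x) m` of every vacuum vector `m` is zero — the closed
span of `⋃ₓ W(x) M₀` is all of `E`. [cite: vonNeumann1931, §5] -/
theorem eq_zero_of_forall_inner_apply_eq_zero (hW : IsWeylSystem J W) {u : E}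
    (h : ∀ (x : V), ∀ m ∈ hW.vacuumSubspace, ⟪u, W x m⟫_ℂ = 0) : u = 0 := by
  refine hW.eq_zero_of_forall_vacuumVec_apply_eq_zero fun a => ?_
  have h0 : ⟪vacuumVec W (W a u), vacuumVec W (W a u)⟫_ℂ = 0 := by
    rw [hW.inner_vacuumVec_comm, hW.vacuumVec_vacuumVec, hW.inner_apply_left]
    exact h (-a) _ (hW.vacuumVec_mem_vacuumSubspace _)
  exact inner_self_eq_zero.mp h0

/-- The span of the translates of the vacuum subspace is dense. [cite: vonNeumann1931, §5] -/
theorem dense_span_apply_vacuumSubspace (hW : IsWeylSystem J W) :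
    Dense ((Submodule.span ℂ {w : E | ∃ (x : V) (m : E), m ∈ hW.vacuumSubspace ∧ w = W x m}) : Set E) := by
  rw [Submodule.dense_iff_topologicalClosure_eq_top, Submodule.topologicalClosure_eq_top_iff, Submodule.eq_bot_iff]
  intro u hu
  rw [Submodule.mem_orthogonal'] at hu
  exact hW.eq_zero_of_forall_inner_apply_eq_zero fun x m hm => hu _ (Submodule.subset_span ⟨x, m, hm, rfl⟩)

/-! ## 4. The commutant preserves the vacuum subspace -/

/-- A bounded operator commuting with every `W(x)` commutes with `P`. [cite: vonNeumann1931, §5] -/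
theorem apply_vacuumVec_of_commute (hW : IsWeylSystem J W) (T : E →L[ℂ] E) (hT : ∀ (x : V) (v : E), T (W x v) = W x (T v))
    (u : E) : T (vacuumVec W u) = vacuumVec W (T u) := by
  unfold vacuumVec
  rw [← T.integral_comp_comm (hW.integrable_gauss_smul_apply u)]
  congr 1
  funext z
  rw [map_smul, hT]

/-- A bounded operator commuting with every `W(x)` preserves the vacuum subspace. [cite: vonNeumann1931, §5] -/
theorem mem_vacuumSubspace_of_commute (hW : IsWeylSystem J W) (T : E →L[ℂ] E)
    (hT : ∀ (x : V) (v : E), T (W x v) = W x (T v)) {m : E} (hm : m ∈ hW.vacuumSubspace) :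
    T m ∈ hW.vacuumSubspace := by
  rw [hW.mem_vacuumSubspace] at hm ⊢
  rw [← hW.apply_vacuumVec_of_commute T hT, hm]

end IsWeylSystem

end Literature.RepresentationTheory.HeisenbergGroup

end
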